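import Literature.Computability.AlgebraicComplexity.ConstantFreeValiant
import Literature.Computability.AlgebraicComplexity.CircuitGateSemantics
import Literature.Computability.AlgebraicComplexity.DeterminantalIdealComplexityDescent
import Summits.ValiantsHypothesis.ValiantsHypothesis.Theorems.TwoAdicLadderTwoIntegralNormalisationDenominators

/-!
# TwoAdicLadder — crux `TwoIntegralNormalisation` (stmt-5947), line `birth`, stub `stub_halfElim`:
# a quantitative clearing exponent `M ≤ B · (formal degree) · (size + 1)`

The landed denominator clearing (`TwoAdicLadderTwoIntegralNormalisationDenominators.lean`,
`clear`) gives `L_S(t^M · f) ≤ L_K(f ⊗ K)` with an UNCONTROLLED `M` (its weighted-sum rule adds the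
operands' exponents). Here the same gate-local transformation is run with the MAX rule for
weighted sums (`clearMax`: semantics `map_eval_clearMax`, `size_clearMax`, `isFanInTwo_clearMax`)
and the exponent is bounded by two syntactic parameters: `clearExpMax_le` — if every gate of `P`
has exactly two operands and every constant / weight `c` has denominator exponent `N c ≤ B`, then
`clearExpMax P ≤ B · P.formalDegree · (P.size + 1)` (tree `ArithCircuit.formalDegree`: inputs `1`,
sums `max`, products `+`; invariant: gate `i` has exponent `≤ B · fdeg · (i + 2)`). Packaged:
`exists_complexity_C_pow_mul_le_of_consts`. Since circuits may be taken of formal degree `≤ n` at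
cost `n² · size + n` (tree `exists_computes_formalDegree_le`), the hypothesis `ScaledHalfElimPoly`
of `halfElim_of_scaledPoly_of_polyDivision` (`…HalfElimKernel.lean`) reduces to the existence of
near-optimal formal-degree-`n` circuits for `per_n` whose constants have POLYNOMIALLY BOUNDED
`2`-adic valuation deficit. Honest framing: `stub_halfElim`, the crux and VP ≠ VNP are NOT proved.
-/

noncomputable section

open MvPolynomial

-- the summit and the problem share the name `ValiantsHypothesis` (D-0017 single-conjunct layout)
set_option linter.dupNamespace false

namespace Summit.ValiantsHypothesis.ValiantsHypothesis.Theorems.TwoAdicLadder.TwoIntegralNormalisation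

open Literature.Computability.AlgebraicComplexity ArithCircuit

universe u v w

section ClearingMax

variable {S : Type u} {K : Type v} {σ : Type w}

section Defs

variable (num : K → S) (N : K → ℕ) (t : S)

/-- The `t`-exponent of a gate, max rule: for a weighted sum `Σ cᵢ • uᵢ` the common exponent
`maxᵢ (N cᵢ + exp uᵢ)`, for a product the sum of the operands' exponents. [folklore] -/
def gateExpMax (E : List ℕ) : Gate K σ → ℕ
  | .sum args => (args.map fun a => N a.1 + opExp N E a.2).foldr max 0
  | .prod args => (args.map (opExp N E)).sum

variable [Monoid S]

/-- The cleared gate, max rule: in a weighted sum the coefficient `cᵢ` becomes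
`t ^ (M - (N cᵢ + exp uᵢ)) * num cᵢ` with `M = gateExpMax`. Same fan-in. [folklore] -/
def gateClearMax (E : List ℕ) : Gate K σ → Gate S σ
  | .sum args => .sum (args.map fun a =>
      (t ^ ((args.map fun a => N a.1 + opExp N E a.2).foldr max 0 - (N a.1 + opExp N E a.2)) *
        num a.1, opClear num a.2))
  | .prod args => .prod (args.map (opClear num))

/-- Clearing a gate list with the max rule: cleared gates and their exponents (left fold).
[folklore] -/
def clearAuxMax (gs : List (Gate K σ)) : List (Gate S σ) × List ℕ :=
  gs.foldl (fun acc g =>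
    (acc.1 ++ [gateClearMax num N t acc.2 g], acc.2 ++ [gateExpMax N acc.2 g])) ([], [])

/-- The cleared circuit, max rule. [folklore] -/
def clearMax (P : ArithCircuit K σ) : ArithCircuit S σ where
  gates := (clearAuxMax num N t P.gates).1
  output := opClear num P.output

/-- Its exponent: `clearMax P` computes `t ^ (clearExpMax P) · P.eval`. [folklore] -/
def clearExpMax (P : ArithCircuit K σ) : ℕ :=
  opExp N (clearAuxMax num N t P.gates).2 P.output

end Defs

section Shape

variable (num : K → S) (N : K → ℕ) (t : S) [Monoid S]

/-- One step of the fold defining `clearAuxMax`. [folklore] -/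
theorem clearAuxMax_append_singleton (gs : List (Gate K σ)) (g : Gate K σ) :
    clearAuxMax num N t (gs ++ [g]) =
      ((clearAuxMax num N t gs).1 ++ [gateClearMax num N t (clearAuxMax num N t gs).2 g],
        (clearAuxMax num N t gs).2 ++ [gateExpMax N (clearAuxMax num N t gs).2 g]) := by
  simp [clearAuxMax, List.foldl_append]

/-- One cleared gate and one exponent per gate. [folklore] -/
theorem length_clearAuxMax (gs : List (Gate K σ)) :
    (clearAuxMax num N t gs).1.length = gs.length ∧
      (clearAuxMax num N t gs).2.length = gs.length := by
  induction gs using List.reverseRecOn with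
  | nil => simp [clearAuxMax]
  | append_singleton gs g ih =>
    rw [clearAuxMax_append_singleton]
    simp [ih.1, ih.2]

/-- Clearing (max rule) does not change the size. [folklore] -/
@[simp] theorem size_clearMax (P : ArithCircuit K σ) : (clearMax num N t P).size = P.size :=
  (length_clearAuxMax num N t P.gates).1

/-- Clearing a gate (max rule) does not change its fan-in. [folklore] -/
theorem fanIn_gateClearMax (E : List ℕ) (g : Gate K σ) :
    (gateClearMax num N t E g).fanIn = g.fanIn := by
  cases g <;> simp [gateClearMax, Gate.fanIn, Gate.args]

/-- Every gate of the cleared list is a cleared gate. [folklore] -/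
theorem mem_clearAuxMax (gs : List (Gate K σ)) :
    ∀ g' ∈ (clearAuxMax num N t gs).1, ∃ (E : List ℕ) (g : Gate K σ), g ∈ gs ∧
      g' = gateClearMax num N t E g := by
  induction gs using List.reverseRecOn with
  | nil => simp [clearAuxMax]
  | append_singleton gs g ih =>
    intro g' hg'
    rw [clearAuxMax_append_singleton] at hg'
    simp only [List.mem_append, List.mem_singleton] at hg'
    rcases hg' with h | h
    · obtain ⟨E, g₀, hg₀, rfl⟩ := ih g' h
      exact ⟨E, g₀, List.mem_append_left _ hg₀, rfl⟩
    · exact ⟨_, g, List.mem_append_right _ (List.mem_singleton_self g), h⟩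

/-- Clearing (max rule) preserves fan-in two. [folklore] -/
theorem isFanInTwo_clearMax {P : ArithCircuit K σ} (hP : P.IsFanInTwo) :
    (clearMax num N t P).IsFanInTwo := by
  intro g' hg'
  obtain ⟨E, g, hg, rfl⟩ := mem_clearAuxMax num N t P.gates g' hg'
  rw [fanIn_gateClearMax]
  exact hP g hg

end Shape

section Semantics

variable [CommSemiring S] [CommSemiring K] (ι : S →+* K) (num : K → S) (N : K → ℕ) (t : S)
  (hnum : ∀ c : K, ι (num c) = ι t ^ N c * c)

include hnum in
/-- Semantics of a cleared gate (max rule): after `ι` it is `t ^ (gateExpMax g)` times the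
original value. [folklore] -/
theorem map_eval_gateClearMax {vals' : List (MvPolynomial σ S)} {vals : List (MvPolynomial σ K)}
    {E : List ℕ}
    (hinv : ∀ j, MvPolynomial.map ι (vals'.getD j 0) = C (ι t ^ E.getD j 0) * vals.getD j 0)
    (g : Gate K σ) :
    MvPolynomial.map ι ((gateClearMax num N t E g).eval vals') =
      C (ι t ^ gateExpMax N E g) * g.eval vals := by
  cases g with
  | sum args =>
    simp only [gateClearMax, gateExpMax, Gate.eval, List.map_map, map_list_sum]
    set M := (args.map fun a => N a.1 + opExp N E a.2).foldr max 0 with hM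
    have hle : ∀ a ∈ args, N a.1 + opExp N E a.2 ≤ M := fun a ha =>
      le_foldr_max_of_mem (List.mem_map.2 ⟨a, ha, rfl⟩)
    have hterm : ∀ a ∈ args,
        (⇑(MvPolynomial.map ι) ∘ (fun a : S × Operand S σ => a.1 • a.2.eval vals') ∘
          (fun a : K × Operand K σ =>
            (t ^ (M - (N a.1 + opExp N E a.2)) * num a.1, opClear num a.2))) a =
        C (ι t ^ M) * (a.1 • a.2.eval vals) := by
      intro a ha
      simp only [Function.comp_apply, smul_eq_C_mul, map_mul, map_C, map_pow,
        map_eval_opClear ι num N t hnum hinv, hnum a.1]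
      have hsplit : M = (M - (N a.1 + opExp N E a.2)) + N a.1 + opExp N E a.2 := by
        have := hle a ha; omega
      conv_rhs => rw [hsplit]
      simp only [pow_add]
      ring
    rw [List.map_congr_left hterm, List.sum_map_mul_left]
  | prod args =>
    simp only [gateClearMax, gateExpMax, Gate.eval, List.map_map, map_list_prod]
    have hterm : ∀ a ∈ args,
        (MvPolynomial.map ι ∘ (fun u : Operand S σ => u.eval vals') ∘ opClear num) a =
          C (ι t ^ opExp N E a) * a.eval vals := fun a _ => by
      simp only [Function.comp_apply, map_eval_opClear ι num N t hnum hinv]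
    rw [List.map_congr_left hterm, prod_map_C_pow_mul]

include hnum in
/-- The invariant of the fold (max rule): after `ι`, the cleared value list is the original one
scaled entrywise by `t ^ (recorded exponent)`. [folklore] -/
theorem map_gateValues_clearAuxMax (gs : List (Gate K σ)) :
    ∀ j, MvPolynomial.map ι ((gateValues (clearAuxMax num N t gs).1).getD j 0) =
      C (ι t ^ (clearAuxMax num N t gs).2.getD j 0) * (gateValues gs).getD j 0 := by
  induction gs using List.reverseRecOn with
  | nil => intro j; simp [clearAuxMax, gateValues]
  | append_singleton gs g ih =>
    intro j
    have hlen := length_clearAuxMax num N t gs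
    have hv' : (gateValues (clearAuxMax num N t gs).1).length = gs.length := by
      rw [gateValues_length, hlen.1]
    have hv : (gateValues gs).length = gs.length := gateValues_length gs
    rw [clearAuxMax_append_singleton, gateValues_append_singleton, gateValues_append_singleton]
    rcases Nat.lt_trichotomy j gs.length with hj | hj | hj
    · rw [getD_concat_of_lt _ _ _ (by rw [hv']; exact hj),
        getD_concat_of_lt _ _ _ (by rw [hlen.2]; exact hj),
        getD_concat_of_lt _ _ _ (by rw [hv]; exact hj)]
      exact ih j
    · subst hj
      rw [getD_concat_of_eq _ _ _ hv'.symm, getD_concat_of_eq _ _ _ hlen.2.symm,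
        getD_concat_of_eq _ _ _ hv.symm]
      exact map_eval_gateClearMax ι num N t hnum ih g
    · rw [getD_of_length_le _ _ (by simp [hv']; omega),
        getD_of_length_le _ _ (by simp [hlen.2]; omega),
        getD_of_length_le _ _ (by simp [hv]; omega)]
      simp

include hnum in
/-- **Semantics (max rule)**: `clearMax P` computes, after `ι`, `t ^ (clearExpMax P) · P.eval`.
[folklore] -/
theorem map_eval_clearMax (P : ArithCircuit K σ) :
    MvPolynomial.map ι (clearMax num N t P).eval = C (ι t ^ clearExpMax num N t P) * P.eval :=
  map_eval_opClear ι num N t hnum (map_gateValues_clearAuxMax ι num N t hnum P.gates) P.output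

end Semantics

section Bound

variable (num : K → S) (N : K → ℕ) (t : S) [Monoid S]

/-- Operands of a gate all of whose constants have exponent `≤ B`, read against exponent and
formal-degree lists satisfying `E_q ≤ B · fdeg_q · (i + 1)` and `1 ≤ fdeg_q` below `i` (lists of
length `i`), have exponent `≤ B · fdeg · (i + 1)` and formal degree `≥ 1`. [folklore] -/
theorem opExp_le {B i : ℕ} {E degs : List ℕ} (hE : E.length = i) (hdegs : degs.length = i)
    (hinv : ∀ q, q < i → E.getD q 0 ≤ B * degs.getD q 1 * (i + 1) ∧ 1 ≤ degs.getD q 1)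
    (u : Operand K σ) (hu : ∀ c ∈ u.consts, N c ≤ B) :
    opExp N E u ≤ B * u.formalDegree degs * (i + 1) ∧ 1 ≤ u.formalDegree degs := by
  cases u with
  | var j => simp [opExp, Operand.formalDegree]
  | const c =>
    simp only [opExp, Operand.formalDegree, mul_one]
    have hc := hu c (by simp [Operand.consts])
    exact ⟨hc.trans (Nat.le_mul_of_pos_right _ (by omega)), le_rfl⟩
  | gate q =>
    simp only [opExp, Operand.formalDegree]
    by_cases hq : q < i
    · exact hinv q hq
    · rw [getD_of_length_le _ _ (by omega), getD_of_length_le _ _ (by omega)]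
      simp

/-- The invariant behind `clearExpMax_le`: for a list of gates each with exactly two operands and
all constants of exponent `≤ B`, the recorded exponent of gate `q` is
`≤ B · fdeg(gate q) · (q + 2)` and its formal degree is `≥ 1`. [folklore] -/
theorem clearAuxMax_getD_le {B : ℕ} (gs : List (Gate K σ)) (hfan : ∀ g ∈ gs, g.fanIn = 2)
    (hB : ∀ g ∈ gs, ∀ c ∈ g.consts, N c ≤ B) :
    ∀ q, q < gs.length →
      (clearAuxMax num N t gs).2.getD q 0 ≤ B * (gateFormalDegrees gs).getD q 1 * (q + 2) ∧
        1 ≤ (gateFormalDegrees gs).getD q 1 := by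
  induction gs using List.reverseRecOn with
  | nil => intro q hq; simp at hq
  | append_singleton gs g ih =>
    have hfan' : ∀ g ∈ gs, g.fanIn = 2 := fun g hg => hfan g (List.mem_append_left _ hg)
    have hB' : ∀ g ∈ gs, ∀ c ∈ g.consts, N c ≤ B := fun g hg => hB g (List.mem_append_left _ hg)
    have ih' := ih hfan' hB'
    have hlen := (length_clearAuxMax num N t gs).2
    have hdl : (gateFormalDegrees gs).length = gs.length := gateFormalDegrees_length gs
    -- the invariant needed by `opExp_le` at index `i = gs.length`
    have hinv : ∀ q, q < gs.length →
        (clearAuxMax num N t gs).2.getD q 0 ≤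
            B * (gateFormalDegrees gs).getD q 1 * (gs.length + 1) ∧
          1 ≤ (gateFormalDegrees gs).getD q 1 := by
      intro q hq
      refine ⟨(ih' q hq).1.trans ?_, (ih' q hq).2⟩
      exact Nat.mul_le_mul_left _ (by omega)
    intro q hq
    rw [clearAuxMax_append_singleton, gateFormalDegrees_append_singleton]
    simp only [List.length_append, List.length_singleton] at hq
    by_cases hq' : q < gs.length
    · rw [getD_concat_of_lt _ _ _ (by rw [hlen]; exact hq'),
        getD_concat_of_lt _ _ _ (by rw [hdl]; exact hq')]
      exact ih' q hq'
    · have hqe : q = gs.length := by omega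
      subst hqe
      rw [getD_concat_of_eq _ _ _ hlen.symm, getD_concat_of_eq _ _ _ hdl.symm]
      have hg2 := hfan g (List.mem_append_right _ (List.mem_singleton_self g))
      have hgB := hB g (List.mem_append_right _ (List.mem_singleton_self g))
      -- the new gate
      cases g with
      | sum args =>
        simp only [gateExpMax, Gate.formalDegree]
        have hops : ∀ a ∈ args,
            opExp N (clearAuxMax num N t gs).2 a.2 ≤
                B * a.2.formalDegree (gateFormalDegrees gs) * (gs.length + 1) ∧
              1 ≤ a.2.formalDegree (gateFormalDegrees gs) := fun a ha =>
          opExp_le N hlen hdl hinv a.2 fun c hc => hgB c (by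
            simp only [Gate.consts, List.mem_append, List.mem_map, List.mem_flatMap]
            exact Or.inr ⟨a, ha, hc⟩)
        have hwt : ∀ a ∈ args, N a.1 ≤ B := fun a ha => hgB a.1 (by
          simp only [Gate.consts, List.mem_append, List.mem_map, List.mem_flatMap]
          exact Or.inl ⟨a, ha, rfl⟩)
        -- formal degree of the sum is ≥ 1 (two operands, each ≥ 1)
        have hne : args ≠ [] := by
          intro h; simp [Gate.fanIn, Gate.args, h] at hg2
        obtain ⟨a₀, ha₀⟩ := List.exists_mem_of_ne_nil args hne
        set F := (args.map fun a => a.2.formalDegree (gateFormalDegrees gs)).foldr max 0 with hF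
        have hF1 : 1 ≤ F :=
          (hops a₀ ha₀).2.trans (le_foldr_max_of_mem (List.mem_map.2 ⟨a₀, ha₀, rfl⟩))
        have hfold : ∀ {l : List ℕ} {b : ℕ}, (∀ m ∈ l, m ≤ b) → l.foldr max 0 ≤ b := by
          intro l b h
          induction l with
          | nil => exact Nat.zero_le _
          | cons x l ihl =>
            simp only [List.foldr_cons]
            exact max_le (h x (by simp)) (ihl fun m hm => h m (by simp [hm]))
        refine ⟨hfold fun m hm => ?_, hF1⟩
        obtain ⟨a, ha, rfl⟩ := List.mem_map.1 hm
        have hfa : a.2.formalDegree (gateFormalDegrees gs) ≤ F :=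
          le_foldr_max_of_mem (List.mem_map.2 ⟨a, ha, rfl⟩)
        calc N a.1 + opExp N (clearAuxMax num N t gs).2 a.2
            ≤ B + B * a.2.formalDegree (gateFormalDegrees gs) * (gs.length + 1) :=
              Nat.add_le_add (hwt a ha) (hops a ha).1
          _ ≤ B * F + B * F * (gs.length + 1) := by
              refine Nat.add_le_add ?_ (Nat.mul_le_mul_right _ (Nat.mul_le_mul_left _ hfa))
              exact Nat.le_mul_of_pos_right _ hF1
          _ = B * F * (gs.length + 2) := by ring
      | prod args =>
        simp only [gateExpMax, Gate.formalDegree]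
        have hops : ∀ u ∈ args,
            opExp N (clearAuxMax num N t gs).2 u ≤
                B * u.formalDegree (gateFormalDegrees gs) * (gs.length + 1) ∧
              1 ≤ u.formalDegree (gateFormalDegrees gs) := fun u hu =>
          opExp_le N hlen hdl hinv u fun c hc => hgB c (by
            simp only [Gate.consts, List.mem_flatMap]
            exact ⟨u, hu, hc⟩)
        -- exactly two operands
        have hlen2 : args.length = 2 := by simpa [Gate.fanIn, Gate.args] using hg2
        match args, hlen2, hops with
        | [u, v], _, hops =>
          simp only [List.map_cons, List.map_nil, List.sum_cons, List.sum_nil, add_zero]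
          have hu := hops u (by simp)
          have hv := hops v (by simp)
          refine ⟨?_, Nat.le_add_right_of_le hu.2⟩
          calc opExp N (clearAuxMax num N t gs).2 u + opExp N (clearAuxMax num N t gs).2 v
              ≤ B * u.formalDegree (gateFormalDegrees gs) * (gs.length + 1) +
                  B * v.formalDegree (gateFormalDegrees gs) * (gs.length + 1) :=
                Nat.add_le_add hu.1 hv.1
            _ = B * (u.formalDegree (gateFormalDegrees gs) +
                  v.formalDegree (gateFormalDegrees gs)) * (gs.length + 1) := by ring
            _ ≤ B * (u.formalDegree (gateFormalDegrees gs) +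
                  v.formalDegree (gateFormalDegrees gs)) * (gs.length + 2) :=
                Nat.mul_le_mul_left _ (by omega)

/-- **The clearing exponent is at most `B · (formal degree) · (size + 1)`** for a circuit in which
every gate has exactly two operands and every constant / weight `c` has `N c ≤ B`. [folklore] -/
theorem clearExpMax_le {B : ℕ} (P : ArithCircuit K σ) (hfan : ∀ g ∈ P.gates, g.fanIn = 2)
    (hB : ∀ c ∈ P.consts, N c ≤ B) :
    clearExpMax num N t P ≤ B * P.formalDegree * (P.size + 1) := by
  have hBg : ∀ g ∈ P.gates, ∀ c ∈ g.consts, N c ≤ B := fun g hg c hc =>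
    hB c (by simp only [ArithCircuit.consts, List.mem_append, List.mem_flatMap]; exact Or.inl ⟨g, hg, hc⟩)
  have hBo : ∀ c ∈ P.output.consts, N c ≤ B := fun c hc =>
    hB c (by simp only [ArithCircuit.consts, List.mem_append]; exact Or.inr hc)
  have hinv := clearAuxMax_getD_le num N t P.gates hfan hBg
  have hlen := (length_clearAuxMax num N t P.gates).2
  have hdl : (gateFormalDegrees P.gates).length = P.gates.length := gateFormalDegrees_length _
  have hinv' : ∀ q, q < P.gates.length →
      (clearAuxMax num N t P.gates).2.getD q 0 ≤
          B * (gateFormalDegrees P.gates).getD q 1 * (P.gates.length + 1) ∧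
        1 ≤ (gateFormalDegrees P.gates).getD q 1 := fun q hq =>
    ⟨(hinv q hq).1.trans (Nat.mul_le_mul_left _ (by omega)), (hinv q hq).2⟩
  exact (opExp_le N hlen hdl hinv' P.output hBo).1

end Bound

/-- **Clearing denominators with a controlled exponent.** Let `ι : S →+* K` be injective and
`ι (num c) = ι t ^ N c * c` for all `c`. If `P` is a `K`-circuit with exactly two operands per
gate computing `f ⊗ K` (`f ∈ S[X]`) and all its constants / weights have `N c ≤ B`, then some
`S`-circuit of the same size computes `t ^ M · f` with `M ≤ B · P.formalDegree · (P.size + 1)`;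
in particular `L_S(t^M · f) ≤ P.size`. [folklore] -/
theorem exists_complexity_C_pow_mul_le_of_consts [CommSemiring S] [CommSemiring K] (ι : S →+* K)
    (hι : Function.Injective ι) (num : K → S) (N : K → ℕ) (t : S)
    (hnum : ∀ c : K, ι (num c) = ι t ^ N c * c) {B : ℕ} (f : MvPolynomial σ S)
    (P : ArithCircuit K σ) (hfan : ∀ g ∈ P.gates, g.fanIn = 2)
    (hPf : P.Computes (MvPolynomial.map ι f)) (hB : ∀ c ∈ P.consts, N c ≤ B) :
    ∃ M : ℕ, M ≤ B * P.formalDegree * (P.size + 1) ∧ complexity (C (t ^ M) * f) ≤ P.size := by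
  refine ⟨clearExpMax num N t P, clearExpMax_le num N t P hfan hB, ?_⟩
  have hP2 : P.IsFanInTwo := fun g hg => (hfan g hg).le
  have hcomp : (clearMax num N t P).Computes (C (t ^ clearExpMax num N t P) * f) := by
    unfold ArithCircuit.Computes at hPf ⊢
    apply MvPolynomial.map_injective ι hι
    rw [map_eval_clearMax ι num N t hnum, hPf, map_mul, map_C, map_pow ι t]
  calc complexity (C (t ^ clearExpMax num N t P) * f) ≤ (clearMax num N t P).size :=
        complexity_le_size (isFanInTwo_clearMax num N t hP2) hcomp
    _ = P.size := size_clearMax num N t P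

end ClearingMax

end Summit.ValiantsHypothesis.ValiantsHypothesis.Theorems.TwoAdicLadder.TwoIntegralNormalisation

end
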